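/-
Copyright (c) 2026 the pub-hodgecm-mathlib formalisation cell (harness21).  Prover seat hodgecm-mathlib-R90-IF-p01 (g0), programme R90-TF, section S9 «InnerForm-13.3.6 (c)»,
socket B3a «ADELIC CONGRUENCE CARRIES DISCRETE P» beneath `R90.S9.sock_S9_similitudeTransport` (EMIT S9 WAVE 1, R90 bus 2026-09-04T15:27:13Z).
-/
import Literature.NumberTheory.Automorphic.AutomorphicSpectrum        -- ★ `AdelicGroupData.L2`, `rightRegular`, `DiscreteAutomorphicRep`
import Literature.NumberTheory.Automorphic.AutomorphicTwist           -- ★ `AdelicGroupData.toAutomorphicQuotient_surjective`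
import Literature.NumberTheory.Automorphic.GLnCuspidalSpectrum        -- ★ `AdelicGroupData.smul_toAutomorphicQuotient`
import Literature.NumberTheory.Automorphic.AdelicSimilitudeCongr      -- ★ `UnitaryGroup.exists_adelicSimilCongr`, `similCongr_mem_quotientSubgroup_iff` (the CM similitude `x ↦ Q x Q⁻¹`)
import HarnessLib

/-!
# R90-TF · S9 — (B3a) «an isomorphism of adelic groups carrying the lattice to the lattice carries automorphic measures, `L²`, and DISCRETE
# AUTOMORPHIC REPRESENTATIONS»; specialised to the rational similitude `U(H)(𝔸) ≃ U(Φ)(𝔸)`, `x ↦ Q x Q⁻¹`, of two similar hermitian forms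

Cell `hodgecm-mathlib`, crux H413 = `stmt-HodgeConjecture-24833` (supports-only, count-neutral), route of record `HCCMUnconditional`.  Programme R90-TF
(HUMAN RULING «R90-TF SLAB — MAX PUSH»; brief `director/R90-BRIEF.v2.md` 1f40d54518340a35), section S9 = InnerForm-13.3.6 (c) (base `R90-IF`); seat R90-IF-p01 (g0);
deal «EMIT S9 WAVE 1» (R90 bus 2026-09-04T15:27:13Z): socket (B3a) of the decl docstring of `R90.S9.SocketSimilitudeTransport` (tree
`Cruxes/H413/Lines/R90_S9_InnerFormTransportB.lean` :184–:202) — «`DiscreteAutomorphicRep` ∕ automorphic-measure ∕ `L²` transport for `adelicGroupData L⁺ L c 3 H` along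
`adelicUnitaryGroupCongr`».  THEOREMS ONLY (no `def`, no `instance`, no named-fact hypothesis, no `sorry`); every transported object is delivered as an
EXISTENCE statement WITH ITS VALUE LAW (the interface style of ★ `AdelicSimilitudeCongr`), so consumers `obtain` it and rewrite with the law.

## Contents (§1–§5 generic: ANY two adelic group data `𝒢, 𝒢'` over `K` and ANY isomorphism of topological groups `Φ : G(𝔸) ≃ G′(𝔸)` with `Φ(A_G·G(K)) = A_{G′}·G′(K)`)
* §1 `exists_automorphicQuotient_congr` — a homeomorphism `Ψ : G(𝔸)⧸A_G G(K) ≃ₜ G′(𝔸)⧸A_{G′} G′(K)`, `Ψ [x] = [Φ x]`; for ANY such `Ψ`: `Ψ (g • q) = Φ g • Ψ q` (`congrQuot_smul`), …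
* §2 `isAutomorphicMeasure_map_congrQuot` — `Ψ_* μ` is an automorphic measure of `𝒢'` (finite, positive on opens, inner regular, `G′(𝔸)`-invariant); `measurePreserving_congrQuot`.
* §3 `exists_L2_congr` — `U : L²(μ) ≃ₗᵢ L²(μ′)`, `U f = f ∘ Ψ⁻¹`, `U⁻¹ f′ = f′ ∘ Ψ` a.e., INTERTWINING the regular representations: `U R(g) = R′(Φ g) U`.
* §4 (representation theory over two groups `θ : G ≃* G′`; the tree's ★ `ClosedSubrep.mapConj` is `G = G′`) — along a `θ`-equivariant `e : V ≃L V′` closed subrepresentations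
  correspond (`exists_closedSubrep_map∕orderIso_of_equivariant`), irreducibility is invariant (`isTopIrreducible_iff_of_equivariant`), `e` restricts (`exists_subrepEquiv_of_equivariant`).
* §5 `exists_discreteAutomorphicRep_congr` — every discrete automorphic `P ⊂ L²(μ)` of `𝒢` is carried to a discrete automorphic `P′ = U(P) ⊂ L²(μ′)` of `𝒢'` with a
  `Φ`-EQUIVARIANT isomorphism `e : P ≃ P′`, `e = U` on vectors.
* §6 the CM similitude (`ᵗ(σQ)·H₀·Q = c • H`, `Q ∈ GL_N(L)`, `c ≠ 0`; (B3)'s `ᵗB̄ (a • Φ₃) B = H` via `formCongr_smul_to_simil`): `exists_similCongr` (★ `exists_adelicSimilCongr` + §1) and the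
  ASSEMBLED **`exists_similCongr_discreteAutomorphicRep`**: `x ↦ Q x Q⁻¹` carries `μ ↦ Ψ_* μ` (automorphic) and `P ↦ P₀` (discrete automorphic, `Φ`-equivariantly isomorphic)
  from `cmDatum L N H` (`= adelicGroupData L⁺ L c N H`, `rfl`) to `cmDatum L N H₀`.
NOT HERE ((B3b)∕(B3c), seats p02∕p03): the value laws of `Φ` at `finAdelicToAdelic`∕`inclPlace`∕`localPiEquiv` (★ `finPart_similCongr`, ★ `AdelicCongruenceLocalCompat`),
`IsConstituentOf`∕`MemXiFamily` riding `e`, the signed `πˢ`-uniqueness.  HONEST LABEL: plumbing; proves no printed statement about automorphic forms; HC_CM is proved only modulo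
the 7 printed citations (2 remaining named inputs: hLiu418 = `stmt-HodgeConjecture-24832`, h413 = `stmt-HodgeConjecture-24833`) until rung 0 closes.

## References
* [PlatonovRapinchuk1994] V. Platonov, A. Rapinchuk, *Algebraic Groups and Number Theory* (1994), §2.3 (equivalent forms have conjugate unitary groups), §5.1.
* [BorelJacquet1979] A. Borel, H. Jacquet, *Automorphic forms and automorphic representations*, PSPM 33.1 (1979), §4.1, §4.6.
* [Rogawski1990] J. D. Rogawski, *Automorphic Representations of Unitary Groups in Three Variables*, Ann. of Math. Stud. 123 (1990), §1.9 p. 8; §14.5 pp. 237–239.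
* [ArthurClozelAMS120] J. Arthur, L. Clozel, *Simple algebras, base change, and the advanced theory of the trace formula* (1989), Ch. 1 §2.1 (transport of structure `Π^σ`).
-/

set_option autoImplicit false
set_option linter.dupNamespace false  -- the mandated namespace repeats the summit's segment (`HodgeConjecture.HodgeConjecture`)

noncomputable section

open NumberField IsDedekindDomain MeasureTheory Topology
open scoped Matrix
open Literature.NumberTheory.Automorphic Literature.NumberTheory.Automorphic.UnitaryGroup

namespace Summit.HodgeConjecture.HodgeConjecture.R90.S9

universe u

/-! ## §1 The homeomorphism of automorphic quotients induced by `Φ` -/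

section Quotient

variable {K : Type} [Field K] [NumberField K] {𝒢 𝒢' : AdelicGroupData.{u} K}

/-- `Φ` respects the left cosets of `A_G · G(K)` when it carries `A_G · G(K)` onto `A_{G′} · G′(K)`. [folklore] -/
theorem leftRel_of_congr (Φ : 𝒢.Adelic ≃ₜ* 𝒢'.Adelic) (hΦ : ∀ x, Φ x ∈ 𝒢'.quotientSubgroup ↔ x ∈ 𝒢.quotientSubgroup)
    (a b : 𝒢.Adelic) (h : QuotientGroup.leftRel 𝒢.quotientSubgroup a b) :
    QuotientGroup.leftRel 𝒢'.quotientSubgroup (Φ a) (Φ b) := by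
  rw [QuotientGroup.leftRel_apply] at h ⊢
  rw [← map_inv, ← map_mul]
  exact (hΦ _).2 h

/-- The lattice hypothesis for `Φ⁻¹`. [folklore] -/
theorem symm_mem_quotientSubgroup_iff (Φ : 𝒢.Adelic ≃ₜ* 𝒢'.Adelic) (hΦ : ∀ x, Φ x ∈ 𝒢'.quotientSubgroup ↔ x ∈ 𝒢.quotientSubgroup)
    (y : 𝒢'.Adelic) : Φ.symm y ∈ 𝒢.quotientSubgroup ↔ y ∈ 𝒢'.quotientSubgroup := by
  rw [← hΦ, ContinuousMulEquiv.apply_symm_apply]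

/-- **The automorphic quotients are homeomorphic along `Φ`**: an isomorphism of topological groups `Φ : G(𝔸) ≃ G′(𝔸)` with `Φ(A_G·G(K)) = A_{G′}·G′(K)` induces a
homeomorphism `Ψ : G(𝔸) ⧸ A_G G(K) ≃ₜ G′(𝔸) ⧸ A_{G′} G′(K)` with `Ψ [x] = [Φ x]` (packaged as an existence statement with its value law; Mathlib `Quotient.map'` both ways).
[cite: PlatonovRapinchuk1994, §2.3, §5.1] [cite: BorelJacquet1979, §4.1] -/
theorem exists_automorphicQuotient_congr (Φ : 𝒢.Adelic ≃ₜ* 𝒢'.Adelic) (hΦ : ∀ x, Φ x ∈ 𝒢'.quotientSubgroup ↔ x ∈ 𝒢.quotientSubgroup) :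
    ∃ Ψ : 𝒢.automorphicQuotient ≃ₜ 𝒢'.automorphicQuotient, ∀ x, Ψ (𝒢.toAutomorphicQuotient x) = 𝒢'.toAutomorphicQuotient (Φ x) := by
  have hΦ' := symm_mem_quotientSubgroup_iff Φ hΦ
  exact ⟨{ toFun := Quotient.map' Φ (leftRel_of_congr Φ hΦ)
           invFun := Quotient.map' Φ.symm (leftRel_of_congr Φ.symm hΦ')
           left_inv := fun q => Quotient.inductionOn' q fun x => congrArg 𝒢.toAutomorphicQuotient (Φ.symm_apply_apply x)
           right_inv := fun q => Quotient.inductionOn' q fun y => congrArg 𝒢'.toAutomorphicQuotient (Φ.apply_symm_apply y)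
           continuous_toFun := Φ.continuous.quotient_map' (leftRel_of_congr Φ hΦ)
           continuous_invFun := Φ.symm.continuous.quotient_map' (leftRel_of_congr Φ.symm hΦ') }, fun _ => rfl⟩

/-- **Equivariance** of any `Ψ` with the value law `Ψ [x] = [Φ x]`: `Ψ (g • q) = Φ g • Ψ q`. [folklore] -/
theorem congrQuot_smul (Φ : 𝒢.Adelic ≃ₜ* 𝒢'.Adelic) (Ψ : 𝒢.automorphicQuotient ≃ₜ 𝒢'.automorphicQuotient)
    (hΨ : ∀ x, Ψ (𝒢.toAutomorphicQuotient x) = 𝒢'.toAutomorphicQuotient (Φ x)) (g : 𝒢.Adelic) (q : 𝒢.automorphicQuotient) :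
    Ψ (g • q) = Φ g • Ψ q := by
  obtain ⟨y, rfl⟩ := 𝒢.toAutomorphicQuotient_surjective q
  rw [AdelicGroupData.smul_toAutomorphicQuotient, hΨ, hΨ, AdelicGroupData.smul_toAutomorphicQuotient, map_mul]

/-- `Ψ⁻¹ [y] = [Φ⁻¹ y]`. [folklore] -/
theorem congrQuot_symm_apply (Φ : 𝒢.Adelic ≃ₜ* 𝒢'.Adelic) (Ψ : 𝒢.automorphicQuotient ≃ₜ 𝒢'.automorphicQuotient)
    (hΨ : ∀ x, Ψ (𝒢.toAutomorphicQuotient x) = 𝒢'.toAutomorphicQuotient (Φ x)) (y : 𝒢'.Adelic) :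
    Ψ.symm (𝒢'.toAutomorphicQuotient y) = 𝒢.toAutomorphicQuotient (Φ.symm y) := by
  apply Ψ.injective
  rw [Ψ.apply_symm_apply, hΨ, ContinuousMulEquiv.apply_symm_apply]

/-- `Ψ⁻¹ (g′ • q′) = Φ⁻¹ g′ • Ψ⁻¹ q′`. [folklore] -/
theorem congrQuot_symm_smul (Φ : 𝒢.Adelic ≃ₜ* 𝒢'.Adelic) (Ψ : 𝒢.automorphicQuotient ≃ₜ 𝒢'.automorphicQuotient)
    (hΨ : ∀ x, Ψ (𝒢.toAutomorphicQuotient x) = 𝒢'.toAutomorphicQuotient (Φ x)) (g' : 𝒢'.Adelic) (q' : 𝒢'.automorphicQuotient) :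
    Ψ.symm (g' • q') = Φ.symm g' • Ψ.symm q' :=
  congrQuot_smul Φ.symm Ψ.symm (congrQuot_symm_apply Φ Ψ hΨ) g' q'

/-! ## §2 Automorphic measures are carried to automorphic measures -/

/-- **The push-forward of an automorphic measure along `Ψ` is an automorphic measure** of `𝒢'`: finite, positive on non-empty open sets (`Ψ` is a continuous surjection),
inner regular (`Ψ` continuous), and `G′(𝔸)`-invariant since `Ψ⁻¹(g′ • s) = Φ⁻¹ g′ • Ψ⁻¹ s`.  (Template: ★ `isAutomorphicMeasure_map_gal_smul`.)
[cite: BorelJacquet1979, §4.1, §4.6] [cite: PlatonovRapinchuk1994, §5.1] -/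
theorem isAutomorphicMeasure_map_congrQuot (Φ : 𝒢.Adelic ≃ₜ* 𝒢'.Adelic) (Ψ : 𝒢.automorphicQuotient ≃ₜ 𝒢'.automorphicQuotient)
    (hΨ : ∀ x, Ψ (𝒢.toAutomorphicQuotient x) = 𝒢'.toAutomorphicQuotient (Φ x)) (μ : Measure 𝒢.automorphicQuotient) [𝒢.IsAutomorphicMeasure μ] :
    𝒢'.IsAutomorphicMeasure (μ.map Ψ) where
  toIsFiniteMeasure := Measure.isFiniteMeasure_map μ _
  toIsOpenPosMeasure := Ψ.continuous.isOpenPosMeasure_map Ψ.surjective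
  toInnerRegularCompactLTTop := Measure.InnerRegularCompactLTTop.map_of_continuous Ψ.continuous
  toSMulInvariantMeasure := ⟨fun g' s hs => by
    rw [Measure.map_apply Ψ.measurable hs, Measure.map_apply Ψ.measurable (measurableSet_preimage (measurable_const_smul g') hs)]
    have : Ψ ⁻¹' ((fun x => g' • x) ⁻¹' s) = (fun x => Φ.symm g' • x) ⁻¹' (Ψ ⁻¹' s) := by
      ext x
      simp only [Set.mem_preimage, congrQuot_smul Φ Ψ hΨ, ContinuousMulEquiv.apply_symm_apply]
    rw [this, SMulInvariantMeasure.measure_preimage_smul _ (Ψ.measurable hs)]⟩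

/-- `Ψ` is measure preserving `μ → Ψ_* μ`. [folklore] -/
theorem measurePreserving_congrQuot (Ψ : 𝒢.automorphicQuotient ≃ₜ 𝒢'.automorphicQuotient) (μ : Measure 𝒢.automorphicQuotient) :
    MeasurePreserving Ψ μ (μ.map Ψ) :=
  ⟨Ψ.measurable, rfl⟩

/-- `Ψ⁻¹` is measure preserving `Ψ_* μ → μ`. [folklore] -/
theorem measurePreserving_congrQuot_symm (Ψ : 𝒢.automorphicQuotient ≃ₜ 𝒢'.automorphicQuotient) (μ : Measure 𝒢.automorphicQuotient) :
    MeasurePreserving Ψ.symm (μ.map Ψ) μ :=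
  (measurePreserving_congrQuot Ψ μ).symm Ψ.toMeasurableEquiv

end Quotient

/-! ## §3 `L²` is carried to `L²`, intertwining the regular representations along `Φ` -/

section L2

/-- Round trip on `Lp`: `(f ∘ e) ∘ e′ = f` for measure-preserving `e`, `e′` with `e (e′ y) = y` (Mathlib `Lp.compMeasurePreserving`, a.e.). [folklore] -/
theorem compMeasurePreserving_comp_eq_self {α β : Type*} [MeasurableSpace α] [MeasurableSpace β] {μa : Measure α} {μb : Measure β}
    {e : α → β} {e' : β → α} (he : MeasurePreserving e μa μb) (he' : MeasurePreserving e' μb μa) (h : ∀ y, e (e' y) = y) (f : Lp ℂ 2 μb) :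
    Lp.compMeasurePreserving e' he' (Lp.compMeasurePreserving e he f) = f := by
  apply Lp.ext
  have h2 : ((Lp.compMeasurePreserving e he f : Lp ℂ 2 μa) : α → ℂ) ∘ e' =ᵐ[μb] ((f : β → ℂ) ∘ e) ∘ e' :=
    he'.quasiMeasurePreserving.ae_eq_comp (Lp.coeFn_compMeasurePreserving f he)
  refine (Lp.coeFn_compMeasurePreserving _ he').trans (h2.trans (Filter.EventuallyEq.of_eq ?_))
  funext y
  simp only [Function.comp_apply, h]

variable {K : Type} [Field K] [NumberField K] {𝒢 𝒢' : AdelicGroupData.{u} K}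

/-- **`L²(μ) ≃ L²(μ′)` along `Ψ`, intertwining `R` with `R′ ∘ Φ`.**  For `Ψ : G(𝔸)⧸A_G G(K) ≃ₜ G′(𝔸)⧸A_{G′} G′(K)` with `Ψ [x] = [Φ x]` and measure preserving `μ → μ′`
(`μ′` invariant), there is a linear isometric equivalence `U : L²(μ) ≃ L²(μ′)` with `U f = f ∘ Ψ⁻¹` a.e., `U⁻¹ f′ = f′ ∘ Ψ` a.e. (Mathlib `Lp.compMeasurePreservingₗᵢ` both
ways), and `U (R(g) f) = R′(Φ g) (U f)` — since `(R(g) f)(Ψ⁻¹ y) = f (g⁻¹ • Ψ⁻¹ y) = f (Ψ⁻¹ ((Φ g)⁻¹ • y))`.  (Template: ★ `galL2Equiv`, ★ `galL2_rightRegular`.)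
[cite: BorelJacquet1979, §4.6] [cite: PlatonovRapinchuk1994, §5.1] -/
theorem exists_L2_congr (Φ : 𝒢.Adelic ≃ₜ* 𝒢'.Adelic) (Ψ : 𝒢.automorphicQuotient ≃ₜ 𝒢'.automorphicQuotient)
    (hΨ : ∀ x, Ψ (𝒢.toAutomorphicQuotient x) = 𝒢'.toAutomorphicQuotient (Φ x))
    (μ : Measure 𝒢.automorphicQuotient) (μ' : Measure 𝒢'.automorphicQuotient)
    [SMulInvariantMeasure 𝒢.Adelic 𝒢.automorphicQuotient μ] [SMulInvariantMeasure 𝒢'.Adelic 𝒢'.automorphicQuotient μ']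
    (hm : MeasurePreserving Ψ μ μ') :
    ∃ U : 𝒢.L2 μ ≃ₗᵢ[ℂ] 𝒢'.L2 μ',
      (∀ f : 𝒢.L2 μ, ((U f : 𝒢'.L2 μ') : 𝒢'.automorphicQuotient → ℂ) =ᵐ[μ'] fun y => (f : 𝒢.automorphicQuotient → ℂ) (Ψ.symm y)) ∧
      (∀ f' : 𝒢'.L2 μ', ((U.symm f' : 𝒢.L2 μ) : 𝒢.automorphicQuotient → ℂ) =ᵐ[μ] fun x => (f' : 𝒢'.automorphicQuotient → ℂ) (Ψ x)) ∧
      ∀ (g : 𝒢.Adelic) (f : 𝒢.L2 μ), U (𝒢.rightRegular μ g f) = 𝒢'.rightRegular μ' (Φ g) (U f) := by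
  have hm' : MeasurePreserving Ψ.symm μ' μ := hm.symm Ψ.toMeasurableEquiv
  refine ⟨{ toLinearEquiv :=
              { (Lp.compMeasurePreservingₗᵢ ℂ (Ψ.symm : 𝒢'.automorphicQuotient → 𝒢.automorphicQuotient) hm').toLinearMap with
                invFun := Lp.compMeasurePreserving Ψ hm
                left_inv := fun f => compMeasurePreserving_comp_eq_self hm' hm Ψ.symm_apply_apply f
                right_inv := fun f' => compMeasurePreserving_comp_eq_self hm hm' Ψ.apply_symm_apply f' }
            norm_map' := fun f => Lp.norm_compMeasurePreserving f hm' }, fun f => ?_, fun f' => ?_, fun g f => ?_⟩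
  · exact Lp.coeFn_compMeasurePreserving f hm'
  · exact Lp.coeFn_compMeasurePreserving f' hm
  · -- `U (R(g) f) = R′(Φ g) (U f)` almost everywhere
    change Lp.compMeasurePreserving Ψ.symm hm' (𝒢.rightRegular μ g f) =
      𝒢'.rightRegular μ' (Φ g) (Lp.compMeasurePreserving Ψ.symm hm' f)
    apply Lp.ext
    have h1 := Lp.coeFn_compMeasurePreserving (𝒢.rightRegular μ g f) hm'
    have h2 : ((𝒢.rightRegular μ g f : 𝒢.L2 μ) : 𝒢.automorphicQuotient → ℂ) ∘ Ψ.symm =ᵐ[μ']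
        (fun x => (f : 𝒢.automorphicQuotient → ℂ) (g⁻¹ • x)) ∘ Ψ.symm :=
      hm'.quasiMeasurePreserving.ae_eq_comp (𝒢.rightRegular_apply_coeFn μ g f)
    have h3 := 𝒢'.rightRegular_apply_coeFn μ' (Φ g) (Lp.compMeasurePreserving Ψ.symm hm' f)
    have h4 : (fun y => ((Lp.compMeasurePreserving Ψ.symm hm' f : 𝒢'.L2 μ') : 𝒢'.automorphicQuotient → ℂ) ((Φ g)⁻¹ • y)) =ᵐ[μ']
        ((f : 𝒢.automorphicQuotient → ℂ) ∘ Ψ.symm) ∘ (fun y => (Φ g)⁻¹ • y) :=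
      (measurePreserving_smul ((Φ g)⁻¹) μ').quasiMeasurePreserving.ae_eq_comp (Lp.coeFn_compMeasurePreserving f hm')
    have h5 : ((f : 𝒢.automorphicQuotient → ℂ) ∘ Ψ.symm) ∘ (fun y => (Φ g)⁻¹ • y) =
        (fun x => (f : 𝒢.automorphicQuotient → ℂ) (g⁻¹ • x)) ∘ Ψ.symm := by
      funext y
      simp only [Function.comp_apply, congrQuot_symm_smul Φ Ψ hΨ, map_inv, ContinuousMulEquiv.symm_apply_apply]
    exact h1.trans (h2.trans ((h3.trans (h4.trans (Filter.EventuallyEq.of_eq h5))).symm))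

end L2

/-! ## §4 Closed subrepresentations and irreducibility along an equivariant isomorphism between representations of DIFFERENT groups -/

section Equivariant

variable {k : Type*} [CommRing k] {G G' : Type*} [Group G] [Group G']
  {V V' : Type*} [AddCommGroup V] [TopologicalSpace V] [IsTopologicalAddGroup V] [Module k V]
  [AddCommGroup V'] [TopologicalSpace V'] [IsTopologicalAddGroup V'] [Module k V']
  {π : ContRepresentation k G V} {π' : ContRepresentation k G' V'}

/-- The inverse of a `θ`-equivariant isomorphism `e (π g v) = π′ (θ g) (e v)` is `θ⁻¹`-equivariant. [folklore] -/
theorem equivariant_symm (e : V ≃L[k] V') (θ : G ≃* G') (he : ∀ g v, e (π g v) = π' (θ g) (e v)) (g' : G') (v' : V') :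
    e.symm (π' g' v') = π (θ.symm g') (e.symm v') := by
  apply e.injective
  rw [e.apply_symm_apply, he, MulEquiv.apply_symm_apply, e.apply_symm_apply]

/-- **Transport of a closed subrepresentation** along a `θ`-equivariant topological linear isomorphism `e : V ≃ V′` (`e (π g v) = π′ (θ g) (e v)`, `θ : G ≃* G′`): the image
`e(W)` is a closed `π′`-invariant subspace, characterised by `v′ ∈ e(W) ↔ e⁻¹ v′ ∈ W`.  (The tree's ★ `ClosedSubrep.mapConj` is the case `G = G′`.)
[cite: ArthurClozelAMS120, Ch. 1 §2.1] -/
theorem exists_closedSubrep_map_of_equivariant (e : V ≃L[k] V') (θ : G ≃* G') (he : ∀ g v, e (π g v) = π' (θ g) (e v))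
    (W : ContRepresentation.ClosedSubrep π) :
    ∃ W' : ContRepresentation.ClosedSubrep π', ∀ v' : V', v' ∈ W' ↔ e.symm v' ∈ W := by
  refine ⟨{ toSubmodule := W.toSubmodule.map (e : V →ₗ[k] V')
            apply_mem_toSubmodule := fun g' => ?_
            isClosed' := ?_ }, fun v' => ?_⟩
  · rintro _ ⟨v, hv, rfl⟩
    refine ⟨π (θ.symm g') v, W.apply_mem _ hv, ?_⟩
    change e (π (θ.symm g') v) = π' g' (e v)
    rw [he, MulEquiv.apply_symm_apply]
  · change IsClosed ((W.toSubmodule.map (e : V →ₗ[k] V') : Submodule k V') : Set V')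
    rw [Submodule.map_coe]
    exact e.isClosed_image.mpr W.isClosed
  · change v' ∈ W.toSubmodule.map (e : V →ₗ[k] V') ↔ _
    constructor
    · rintro ⟨v, hv, rfl⟩
      change e.symm (e v) ∈ W
      rwa [e.symm_apply_apply]
    · intro h
      exact ⟨e.symm v', h, e.apply_symm_apply v'⟩

/-- **The lattices of closed subrepresentations are isomorphic** along a `θ`-equivariant topological linear isomorphism (`W ↦ e(W)`, inverse `W′ ↦ e⁻¹(W′)`).
[cite: ArthurClozelAMS120, Ch. 1 §2.1] -/
theorem exists_closedSubrep_orderIso_of_equivariant (e : V ≃L[k] V') (θ : G ≃* G') (he : ∀ g v, e (π g v) = π' (θ g) (e v)) :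
    ∃ Λ : ContRepresentation.ClosedSubrep π ≃o ContRepresentation.ClosedSubrep π',
      ∀ (W : ContRepresentation.ClosedSubrep π) (v' : V'), v' ∈ Λ W ↔ e.symm v' ∈ W := by
  choose F hF using fun W => exists_closedSubrep_map_of_equivariant e θ he W
  choose F' hF' using fun W' => exists_closedSubrep_map_of_equivariant e.symm θ.symm (equivariant_symm e θ he) W'
  refine ⟨{ toFun := F
            invFun := F'
            left_inv := fun W => ContRepresentation.ClosedSubrep.ext fun v => by rw [hF', hF, e.symm_symm, e.symm_apply_apply]
            right_inv := fun W' => ContRepresentation.ClosedSubrep.ext fun v' => by rw [hF, hF', e.symm_symm, e.apply_symm_apply]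
            map_rel_iff' := fun {W₁ W₂} => ?_ }, hF⟩
  change F W₁ ≤ F W₂ ↔ W₁ ≤ W₂
  constructor
  · intro h v hv
    have h1 : e v ∈ F W₁ := (hF W₁ (e v)).2 (by rwa [e.symm_apply_apply])
    have h2 := (hF W₂ (e v)).1 (h h1)
    rwa [e.symm_apply_apply] at h2
  · intro h v' hv'
    exact (hF W₂ v').2 (h ((hF W₁ v').1 hv'))

/-- **Topological irreducibility is invariant** under a `θ`-equivariant topological linear isomorphism between representations of (possibly different) groups
`G ≃ G′`. [cite: ArthurClozelAMS120, Ch. 1 §2.1] -/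
theorem isTopIrreducible_iff_of_equivariant [T1Space V] [T1Space V'] (e : V ≃L[k] V') (θ : G ≃* G')
    (he : ∀ g v, e (π g v) = π' (θ g) (e v)) : π.IsTopIrreducible ↔ π'.IsTopIrreducible := by
  obtain ⟨Λ, -⟩ := exists_closedSubrep_orderIso_of_equivariant e θ he
  exact Λ.isSimpleOrder_iff

/-- **Restriction of `e` to `W ≃ e(W)`** is again a `θ`-equivariant topological linear isomorphism, and it is `e` on vectors. [folklore] -/
theorem exists_subrepEquiv_of_equivariant (e : V ≃L[k] V') (θ : G ≃* G') (he : ∀ g v, e (π g v) = π' (θ g) (e v))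
    (W : ContRepresentation.ClosedSubrep π) (W' : ContRepresentation.ClosedSubrep π') (hW' : ∀ v' : V', v' ∈ W' ↔ e.symm v' ∈ W) :
    ∃ eW : W.toSubmodule ≃L[k] W'.toSubmodule,
      (∀ w : W.toSubmodule, ((eW w : W'.toSubmodule) : V') = e w) ∧
      ∀ (g : G) (w : W.toSubmodule), eW (W.toContRep g w) = W'.toContRep (θ g) (eW w) := by
  have hmem : ∀ w : W.toSubmodule, e (w : V) ∈ W' := fun w => (hW' _).2 (by rw [e.symm_apply_apply]; exact w.2)
  refine ⟨{ toLinearEquiv :=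
              { toFun := fun w => ⟨e (w : V), hmem w⟩
                map_add' := fun w w' => Subtype.ext (map_add e (w : V) (w' : V))
                map_smul' := fun c w => Subtype.ext (map_smul e c (w : V))
                invFun := fun w' => ⟨e.symm (w' : V'), (hW' _).1 w'.2⟩
                left_inv := fun w => Subtype.ext (e.symm_apply_apply (w : V))
                right_inv := fun w' => Subtype.ext (e.apply_symm_apply (w' : V')) }
            continuous_toFun := (e.continuous.comp continuous_subtype_val).subtype_mk _
            continuous_invFun := (e.symm.continuous.comp continuous_subtype_val).subtype_mk _ }, fun w => rfl, fun g w => ?_⟩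
  exact Subtype.ext (he g (w : V))

end Equivariant

/-! ## §5 Discrete automorphic representations are carried to discrete automorphic representations -/

section Discrete

variable {K : Type} [Field K] [NumberField K] {𝒢 𝒢' : AdelicGroupData.{u} K}

/-- **Transport of a discrete automorphic representation along an intertwiner `U : L²(μ) ≃ L²(μ′)`, `U R(g) = R′(Φ g) U`**: the image `U(P)` is an irreducible closed
subrepresentation of `L²(μ′)` — a discrete automorphic representation `P′` of `𝒢'` — with membership law `f′ ∈ P′ ↔ U⁻¹ f′ ∈ P` and the `Φ`-equivariant isomorphism
`P ≃ P′` given by `U` on vectors. [cite: BorelJacquet1979, §4.6] [cite: ArthurClozelAMS120, Ch. 1 §2.1] -/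
theorem exists_discreteAutomorphicRep_of_intertwiner (Φ : 𝒢.Adelic ≃ₜ* 𝒢'.Adelic)
    (μ : Measure 𝒢.automorphicQuotient) (μ' : Measure 𝒢'.automorphicQuotient)
    [SMulInvariantMeasure 𝒢.Adelic 𝒢.automorphicQuotient μ] [SMulInvariantMeasure 𝒢'.Adelic 𝒢'.automorphicQuotient μ']
    (U : 𝒢.L2 μ ≃L[ℂ] 𝒢'.L2 μ') (hU : ∀ (g : 𝒢.Adelic) (f : 𝒢.L2 μ), U (𝒢.rightRegular μ g f) = 𝒢'.rightRegular μ' (Φ g) (U f))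
    (P : DiscreteAutomorphicRep 𝒢 μ) :
    ∃ P' : DiscreteAutomorphicRep 𝒢' μ',
      (∀ f' : 𝒢'.L2 μ', f' ∈ P'.space ↔ U.symm f' ∈ P.space) ∧
      ∃ e : P.space.toSubmodule ≃L[ℂ] P'.space.toSubmodule,
        (∀ w : P.space.toSubmodule, ((e w : P'.space.toSubmodule) : 𝒢'.L2 μ') = U w) ∧
        ∀ (g : 𝒢.Adelic) (w : P.space.toSubmodule), e (P.space.toContRep g w) = P'.space.toContRep (Φ g) (e w) := by
  have he : ∀ (g : 𝒢.Adelic) (f : 𝒢.L2 μ), U (𝒢.rightRegular μ g f) = 𝒢'.rightRegular μ' (Φ.toMulEquiv g) (U f) := hU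
  obtain ⟨W', hW'⟩ := exists_closedSubrep_map_of_equivariant U Φ.toMulEquiv he P.space
  obtain ⟨eW, heW, heq⟩ := exists_subrepEquiv_of_equivariant U Φ.toMulEquiv he P.space W' hW'
  exact ⟨⟨W', (isTopIrreducible_iff_of_equivariant eW Φ.toMulEquiv heq).1 P.irreducible⟩, hW', eW, heW, heq⟩

/-- **(B3a, generic form) DISCRETE AUTOMORPHIC REPRESENTATIONS ARE CARRIED ALONG `Φ`.**  For an isomorphism of topological groups `Φ : G(𝔸) ≃ G′(𝔸)` carrying `A_G·G(K)` onto
`A_{G′}·G′(K)`, a homeomorphism `Ψ` of automorphic quotients with `Ψ [x] = [Φ x]` (§1), measure preserving `μ → μ′` between invariant measures (§2: e.g. `μ′ = Ψ_* μ`):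
there is a linear isometric equivalence `U : L²(μ) ≃ L²(μ′)`, `U f = f ∘ Ψ⁻¹`, `U⁻¹ f′ = f′ ∘ Ψ` (a.e.), `U R(g) = R′(Φ g) U`, and every discrete automorphic representation
`P ⊂ L²(μ)` of `𝒢` is carried to a discrete automorphic representation `P′ = U(P) ⊂ L²(μ′)` of `𝒢'` (`f′ ∈ P′ ↔ U⁻¹ f′ ∈ P`) with a `Φ`-EQUIVARIANT isomorphism `e : P ≃ P′`,
`e = U` on vectors: `e (P(g) w) = P′(Φ g) (e w)`.  [cite: BorelJacquet1979, §4.6] [cite: PlatonovRapinchuk1994, §2.3, §5.1] [cite: ArthurClozelAMS120, Ch. 1 §2.1] -/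
theorem exists_discreteAutomorphicRep_congr (Φ : 𝒢.Adelic ≃ₜ* 𝒢'.Adelic) (Ψ : 𝒢.automorphicQuotient ≃ₜ 𝒢'.automorphicQuotient)
    (hΨ : ∀ x, Ψ (𝒢.toAutomorphicQuotient x) = 𝒢'.toAutomorphicQuotient (Φ x))
    (μ : Measure 𝒢.automorphicQuotient) (μ' : Measure 𝒢'.automorphicQuotient)
    [SMulInvariantMeasure 𝒢.Adelic 𝒢.automorphicQuotient μ] [SMulInvariantMeasure 𝒢'.Adelic 𝒢'.automorphicQuotient μ']
    (hm : MeasurePreserving Ψ μ μ') (P : DiscreteAutomorphicRep 𝒢 μ) :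
    ∃ (U : 𝒢.L2 μ ≃ₗᵢ[ℂ] 𝒢'.L2 μ') (P' : DiscreteAutomorphicRep 𝒢' μ') (e : P.space.toSubmodule ≃L[ℂ] P'.space.toSubmodule),
      (∀ f : 𝒢.L2 μ, ((U f : 𝒢'.L2 μ') : 𝒢'.automorphicQuotient → ℂ) =ᵐ[μ'] fun y => (f : 𝒢.automorphicQuotient → ℂ) (Ψ.symm y)) ∧
      (∀ f' : 𝒢'.L2 μ', ((U.symm f' : 𝒢.L2 μ) : 𝒢.automorphicQuotient → ℂ) =ᵐ[μ] fun x => (f' : 𝒢'.automorphicQuotient → ℂ) (Ψ x)) ∧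
      (∀ (g : 𝒢.Adelic) (f : 𝒢.L2 μ), U (𝒢.rightRegular μ g f) = 𝒢'.rightRegular μ' (Φ g) (U f)) ∧
      (∀ f' : 𝒢'.L2 μ', f' ∈ P'.space ↔ U.symm f' ∈ P.space) ∧
      (∀ w : P.space.toSubmodule, ((e w : P'.space.toSubmodule) : 𝒢'.L2 μ') = U w) ∧
      ∀ (g : 𝒢.Adelic) (w : P.space.toSubmodule), e (P.space.toContRep g w) = P'.space.toContRep (Φ g) (e w) := by
  obtain ⟨U, hU1, hU2, hU3⟩ := exists_L2_congr Φ Ψ hΨ μ μ' hm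
  obtain ⟨P', hP', e, he1, he2⟩ :=
    exists_discreteAutomorphicRep_of_intertwiner Φ μ μ' (U.toContinuousLinearEquiv : 𝒢.L2 μ ≃L[ℂ] 𝒢'.L2 μ') (fun g f => hU3 g f) P
  exact ⟨U, P', e, hU1, hU2, hU3, hP', he1, he2⟩

end Discrete

/-! ## §6 The CM similitude `U(H)(𝔸) ≃ U(H₀)(𝔸)`, `x ↦ Q x Q⁻¹`, along `ᵗ(σQ)·H₀·Q = c • H` -/

section CM

/-- **(B3)'s hypothesis read as a similitude**: `ᵗ(σB)·(a • M)·B = H` with `a ≠ 0` (a field) gives `ᵗ(σB)·M·B = a⁻¹ • H` — the shape ★ `exists_adelicSimilCongr` consumes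
(for (B3): `M = Φ₃ = qsForm L`, so `U(H)(𝔸) ≃ U(Φ₃)(𝔸)` along `B`). [cite: Rogawski1990, §1.9 p. 8] [cite: PlatonovRapinchuk1994, §2.3] -/
theorem formCongr_smul_to_simil {R : Type*} [Field R] {n : Type*} [Fintype n] [DecidableEq n] (σ : R →+* R) (B : GL n R) {a : R} (ha : a ≠ 0)
    (M H : Matrix n n R) (h : formCongr σ B (a • M) = H) :
    ((B : Matrix n n R).map σ)ᵀ * M * (B : Matrix n n R) = a⁻¹ • H := by
  rw [← h]
  change _ = a⁻¹ • (((B : Matrix n n R).map σ)ᵀ * (a • M) * (B : Matrix n n R))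
  rw [Matrix.mul_smul, Matrix.smul_mul, smul_smul, inv_mul_cancel₀ ha, one_smul]

variable (L : Type) [Field L] [NumberField L] [IsCMField L] (N : ℕ) (H₀ H : Matrix (Fin N) (Fin N) L)

/-- **The CM similitude on adelic points and on automorphic quotients.**  For `ᵗ(σQ)·H₀·Q = c • H` (`Q ∈ GL_N(L)`, `c ≠ 0`): the isomorphism of topological groups
`Φ : U(H)(𝔸_{L⁺}) ≃ U(H₀)(𝔸_{L⁺})`, `Φ x = Q_𝔸 · x · Q_𝔸⁻¹` (★ `exists_adelicSimilCongr`), carries `U(H)(L⁺)` onto `U(H₀)(L⁺)` (★ `similCongr_mem_quotientSubgroup_iff`;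
`A_G = 1` for `cmDatum`), hence (§1) induces a homeomorphism `Ψ : U(H)(L⁺)\U(H)(𝔸) ≃ₜ U(H₀)(L⁺)\U(H₀)(𝔸)`, `Ψ [x] = [Q x Q⁻¹]`.  (`cmDatum L N · = adelicGroupData L⁺ L c N ·`,
★ `adelicGroupData_eq_cmDatum`, `rfl`.) [cite: PlatonovRapinchuk1994, §2.3, §5.1] [cite: Rogawski1990, §14.5 p. 238] -/
theorem exists_similCongr (c : L) (hc : c ≠ 0) (Q : GL (Fin N) L)
    (hQ : (((Q : GL (Fin N) L) : Matrix (Fin N) (Fin N) L).map (cmConjRingHom L))ᵀ * H₀ * ((Q : GL (Fin N) L) : Matrix (Fin N) (Fin N) L) = c • H) :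
    ∃ (Φ : (cmDatum L N H).Adelic ≃ₜ* (cmDatum L N H₀).Adelic) (Ψ : (cmDatum L N H).automorphicQuotient ≃ₜ (cmDatum L N H₀).automorphicQuotient),
      (∀ x : (cmDatum L N H).Adelic, (Subtype.val (Φ x) : GL (Fin N) (AdeleRing (𝓞 L) L)) =
          toAdeleGL L Q * (Subtype.val x : GL (Fin N) (AdeleRing (𝓞 L) L)) * (toAdeleGL L Q)⁻¹) ∧
      (∀ x : (cmDatum L N H).Adelic, Φ x ∈ (cmDatum L N H₀).quotientSubgroup ↔ x ∈ (cmDatum L N H).quotientSubgroup) ∧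
      ∀ x : (cmDatum L N H).Adelic, Ψ ((cmDatum L N H).toAutomorphicQuotient x) = (cmDatum L N H₀).toAutomorphicQuotient (Φ x) := by
  obtain ⟨Φ, hΦ⟩ := exists_adelicSimilCongr L N H₀ H c hc Q hQ
  obtain ⟨Ψ, hΨ⟩ := exists_automorphicQuotient_congr Φ (similCongr_mem_quotientSubgroup_iff L N H₀ H c hc Q hQ Φ hΦ)
  exact ⟨Φ, Ψ, hΦ, similCongr_mem_quotientSubgroup_iff L N H₀ H c hc Q hQ Φ hΦ, hΨ⟩

/-- **(B3a) THE RATIONAL SIMILITUDE `x ↦ Q x Q⁻¹ : U(H)(𝔸) ≃ U(H₀)(𝔸)` CARRIES AUTOMORPHIC MEASURES, `L²`, AND DISCRETE AUTOMORPHIC REPRESENTATIONS OF `U(H)` TO THOSE OF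
`U(H₀)`** (`ᵗ(σQ)·H₀·Q = c • H`; for (B3): `H₀ = Φ₃ = qsForm L`, `Q = B`, `c = a⁻¹` by `formCongr_smul_to_simil`).  Given an automorphic measure `μ` on `U(H)(L⁺)\U(H)(𝔸)`
and a discrete automorphic representation `P ⊂ L²(μ)` of `cmDatum L N H` (`= adelicGroupData L⁺ L c N H`, `rfl`): there are `Φ` (value law `Φ x = Q_𝔸 x Q_𝔸⁻¹`, lattice law),
`Ψ` (`Ψ [x] = [Φ x]`), the AUTOMORPHIC measure `Ψ_* μ` of `cmDatum L N H₀` (`Ψ` measure preserving), a linear isometric equivalence `U : L²(μ) ≃ L²(Ψ_* μ)` (`U f = f ∘ Ψ⁻¹`,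
`U⁻¹ f₀ = f₀ ∘ Ψ` a.e.; `U R(g) = R₀(Φ g) U`), the discrete automorphic representation `P₀ = U(P)` of `cmDatum L N H₀` (`f₀ ∈ P₀ ↔ U⁻¹ f₀ ∈ P`) and a `Φ`-EQUIVARIANT
isomorphism `e : P ≃ P₀`, `e = U` on vectors, `e (P(g) w) = P₀(Q g Q⁻¹) (e w)`.  Assembly of §1–§5 with ★ `exists_adelicSimilCongr`.
[cite: PlatonovRapinchuk1994, §2.3, §5.1] [cite: BorelJacquet1979, §4.1, §4.6] [cite: Rogawski1990, §1.9 p. 8; §14.5 pp. 237–239] [cite: ArthurClozelAMS120, Ch. 1 §2.1] -/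
theorem exists_similCongr_discreteAutomorphicRep (c : L) (hc : c ≠ 0) (Q : GL (Fin N) L)
    (hQ : (((Q : GL (Fin N) L) : Matrix (Fin N) (Fin N) L).map (cmConjRingHom L))ᵀ * H₀ * ((Q : GL (Fin N) L) : Matrix (Fin N) (Fin N) L) = c • H)
    (μ : Measure (cmDatum L N H).automorphicQuotient) [(cmDatum L N H).IsAutomorphicMeasure μ] (P : DiscreteAutomorphicRep (cmDatum L N H) μ) :
    ∃ (Φ : (cmDatum L N H).Adelic ≃ₜ* (cmDatum L N H₀).Adelic) (Ψ : (cmDatum L N H).automorphicQuotient ≃ₜ (cmDatum L N H₀).automorphicQuotient)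
      (_ : (cmDatum L N H₀).IsAutomorphicMeasure (μ.map Ψ))
      (U : (cmDatum L N H).L2 μ ≃ₗᵢ[ℂ] (cmDatum L N H₀).L2 (μ.map Ψ)) (P₀ : DiscreteAutomorphicRep (cmDatum L N H₀) (μ.map Ψ))
      (e : P.space.toSubmodule ≃L[ℂ] P₀.space.toSubmodule),
      (∀ x : (cmDatum L N H).Adelic, (Subtype.val (Φ x) : GL (Fin N) (AdeleRing (𝓞 L) L)) =
          toAdeleGL L Q * (Subtype.val x : GL (Fin N) (AdeleRing (𝓞 L) L)) * (toAdeleGL L Q)⁻¹) ∧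
      (∀ x : (cmDatum L N H).Adelic, Φ x ∈ (cmDatum L N H₀).quotientSubgroup ↔ x ∈ (cmDatum L N H).quotientSubgroup) ∧
      (∀ x : (cmDatum L N H).Adelic, Ψ ((cmDatum L N H).toAutomorphicQuotient x) = (cmDatum L N H₀).toAutomorphicQuotient (Φ x)) ∧
      MeasurePreserving Ψ μ (μ.map Ψ) ∧
      (∀ f : (cmDatum L N H).L2 μ, ((U f : (cmDatum L N H₀).L2 (μ.map Ψ)) : (cmDatum L N H₀).automorphicQuotient → ℂ) =ᵐ[μ.map Ψ]
          fun y => (f : (cmDatum L N H).automorphicQuotient → ℂ) (Ψ.symm y)) ∧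
      (∀ f₀ : (cmDatum L N H₀).L2 (μ.map Ψ), ((U.symm f₀ : (cmDatum L N H).L2 μ) : (cmDatum L N H).automorphicQuotient → ℂ) =ᵐ[μ]
          fun x => (f₀ : (cmDatum L N H₀).automorphicQuotient → ℂ) (Ψ x)) ∧
      (∀ (g : (cmDatum L N H).Adelic) (f : (cmDatum L N H).L2 μ), U ((cmDatum L N H).rightRegular μ g f) = (cmDatum L N H₀).rightRegular (μ.map Ψ) (Φ g) (U f)) ∧
      (∀ f₀ : (cmDatum L N H₀).L2 (μ.map Ψ), f₀ ∈ P₀.space ↔ U.symm f₀ ∈ P.space) ∧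
      (∀ w : P.space.toSubmodule, ((e w : P₀.space.toSubmodule) : (cmDatum L N H₀).L2 (μ.map Ψ)) = U w) ∧
      ∀ (g : (cmDatum L N H).Adelic) (w : P.space.toSubmodule), e (P.space.toContRep g w) = P₀.space.toContRep (Φ g) (e w) := by
  obtain ⟨Φ, Ψ, hΦ, hlat, hΨ⟩ := exists_similCongr L N H₀ H c hc Q hQ
  haveI hμ₀ : (cmDatum L N H₀).IsAutomorphicMeasure (μ.map Ψ) := isAutomorphicMeasure_map_congrQuot Φ Ψ hΨ μ
  obtain ⟨U, P₀, e, hU1, hU2, hU3, hP₀, he1, he2⟩ := exists_discreteAutomorphicRep_congr Φ Ψ hΨ μ (μ.map Ψ) (measurePreserving_congrQuot Ψ μ) P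
  exact ⟨Φ, Ψ, hμ₀, U, P₀, e, hΦ, hlat, hΨ, measurePreserving_congrQuot Ψ μ, hU1, hU2, hU3, hP₀, he1, he2⟩

end CM

end Summit.HodgeConjecture.HodgeConjecture.R90.S9

end
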